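/-
Copyright: the b2b-balaban T⁴-continuum CRUX team, row NE7b OWNER lineage `t4-ne7b-p1` (gen 126). Project licence.
-/
import Summits.QuantumFields.BalabanUV.T4Continuum.Spine.NE7b.SupZdCouplingShiftColumn

/-!
# THE CONDITIONAL STRUCTURE IS COUPLING-FREE: on `ℤ^d`, for the `H + K` column, the fluctuation covariance `C_K` and the response
# kernels `h^K_{b₀}` DO NOT DEPEND ON THE BLOCK-SPIN COUPLING `a` — a fluctuation part `w` (`Q′w = 0`) does not see the coupling at all
# (`(H_{V,a′} + K)w = (H_{V,a} + K)w`, since `H_{V,a′} − H_{V,a} = (a′−a)Π` and `Πw = 0`), a response kernel sees it only through a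
# block-constant source, and BOTH are determined by their displays (`Q′`-image + `(H+K)`-image modulo block-constant functions): the
# UNIQUENESS OF FLUCTUATION PARTS (§1).  With (258)∕(259) (`N_{a′} = N_a + (a′−a)·1`) the whole next-scale triple `(N, h, C)` of the
# road has EXPLICIT coupling dependence — the diagonal of `N` moves by `a′ − a`, nothing else moves; § [NE7bP1-G125-HANDOFF] NEXT (3)(a)
# (the a-uniformity audit) is answered for the triple without re-threading a constant (row NE7b, node U5c; (258) + (203)∕(234) BY NAME;
# [folklore] — «the soft coupling only enters the block-field marginal»)

Cell `pub-balaban`, sub-cell `t4`, spine estimate NE7b (`T4WeightBudget.RelWeightBound`; the cell's OWN estimate — NOT PRINTED in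
[Bałaban 1983–89], NOT PROVED).  Crux-route work under `Spine/NE7b/` by the row OWNER (`t4-ne7b-p1` gen 126, file (260)) under FREEZE
(0)'s crux-prover clause, on § [NE7bP1-G125-HANDOFF] NEXT (3)(a); NOTHING of Bałaban's is named as a Lean object, valued or asserted; no
`T4Continuum/Support` leaf typed; no `def`, no notation (columns, left inverses, fluctuation parts and response kernels are ANY data with the
displayed clauses — (216)∕(220)∕(221)∕(222)∕(246) supply them at each coupling, (237) (U) the uniqueness clause); zero `sorry`.  Imports (BY
NAME): the OWNER's (258) `…SupZdCouplingShiftColumn` (`column_superposition`; through it (203) `kernel_comp_apply`, (234) `coarse_entry_le`,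
(27) `blk_chart`).

WHY (located).  (258)∕(259) made the coupling dependence of the next-scale HESSIAN explicit (`N_{a′} = N_a + ε·1`).  The other two objects
the renormalisation step consumes are the response `h^K_{b₀} = Σ′N(b′,b₀)Ψ_{b′}` ((220)) and the fluctuation covariance `C_Kf` ((221)), each
DEFINED through the coupling-`a` column but CHARACTERISED by displays that mention the coupling only through `H_{V,a}` acting on them:
`Q′h_{b₀} = e_{b₀}`, `(H+K)h_{b₀} = ` block-constant; `Q′(C_Kf) = 0`, `(H+K)(C_Kf) = f − ` block-constant.  §1 proves these displays
DETERMINE the object: a bounded `w` with `Q′w = 0` and `(H_{V,a} + K)w = g∘blk` (`g` of coarse profile) vanishes — `w` equals the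
superposition `Σ′_bg(b)Ψ_b` ((258) §1 + (U)), whose block means `Σ′_bT(b′,b)g(b)` then vanish, and a decaying LEFT inverse of `T` re-associated
through the bounded `g` ((203)) gives `g = 0`.  Since `Πw = 0` for a fluctuation part, `(H_{V,a′} + K)w = (H_{V,a} + K)w` and the `a`-object
satisfies the `a′`-displays verbatim (§2: `C_{a′}f = C_af`); for the response the `a′`-source is `(N_a(·,b₀) + εe_{b₀})∘blk`, again
block-constant (§3: `h^{a′}_{b₀} = h^a_{b₀}`, and comparing sources `N_{a′}(·,b₀) = N_a(·,b₀) + εe_{b₀}` — the Hessian shift once more, column by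
column, WITHOUT (222) (C5)).  So along the composed couplings `c_k ∈ (a(1 − (n+1)^{−d}), a]` of (255) the response and the covariance — with
ALL their constants (profiles (220)∕(221), Lipschitz (223)∕(225)∕(249), torus limits (244)∕(248), symmetry (256), positivity (257)) — are
literally the same objects as at the reference coupling.

WHAT IS PROVED ([folklore]; every mesh `n`, ANY `a, a′ : ℝ`, ANY `V`, kernel `|K(p,q)| ≤ εe^{−γ|p−q|₁}`):
* §1 **`fluctuation_unique`** (columns `Ψ` of block profile at coupling `a`, (U) at `a`, a decaying LEFT inverse `N` of `T` ⟹ a bounded `w`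
  with `Q′w = 0` and `(H_{V,a} + K)w = g∘blk`, `|g(b)| ≤ C_ge^{−ν|b−c₀|₁}`, is `0` — and so is `g`).
* §2 **`fluctuation_coupling_invariant`** (bounded `w, w′` with `Q′w = Q′w′ = 0`, `(H_{V,a} + K)w = f − c∘blk`, `(H_{V,a′} + K)w′ = f − c′∘blk`,
  `c, c′` of coarse profile ⟹ `w = w′` and `c = c′`: `C_{a′}f = C_af`).
* §3 THE END **`response_coupling_invariant`** (bounded `h, h′` with `Q′h = Q′h′ = e_{b₀}`, `(H_{V,a} + K)h = m∘blk`, `(H_{V,a′} + K)h′ = m′∘blk`,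
  `m, m′` of coarse profile about `b₀` ⟹ `h = h′` and `m′ = m + (a′−a)e_{b₀}`: `h^{a′}_{b₀} = h^a_{b₀}` and `N_{a′}(·,b₀) = N_a(·,b₀) + (a′−a)e_{b₀}`).
* §4 toy.

HONEST (what this is NOT).  Kernel algebra for ANY objects with the displayed clauses; existence of the objects at each coupling and the
uniqueness clause (U) are INPUTS (each coupling needs its own smallness of `K` against its own constants — the invariance says the OBJECTS
agree where both exist, not that the existence ranges agree); the coarse data are taken with profiles about one centre; scalar skeleton
((A3), NC-NE7b-α UNRULED); nothing of the torus; nothing of the covariant propagators of [B4]–[B6]; nothing of Bałaban's asserted.  BY-NAME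
EFFECT ON THE WALL: NONE.  NE7b NOT PRINTED ∕ NOT PROVED; spine PROVED 0∕9; rung (B)+1 — the programme's measures remain FINITE-torus
statements; NOT the mass gap, NOT Clay.  HONEST DEPENDENCY: continuum YM on T⁴ ⇐ BetaPertH ∧ nine spine estimates (0∕9 proved); BetaPertH
⇐ (D1) ∧ (D4) ∧ CAP+tail; G-an2-4 gates asym, D1 and NE2∕3∕4.
-/

set_option autoImplicit false

noncomputable section

namespace Summit.QuantumFields.BalabanUV.T4Continuum.NE7b.SupZdCouplingInvariance

open Real Filter Topology
open Literature.MathematicalPhysics.QuantumFieldTheory.Balaban1983to89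
open B6QGQLower276 (X e blk B chart mem_B sum_B_const blk_chart)
open SupZdCoarseForm (natAbs_sub_comm_sum)
open SupZdCoarseInverseOperator (kernel_comp_apply)
open SupZdPerturbedCoarseForm (coarse_entry_le)
open SupZdCouplingShiftColumn (column_superposition)

variable {d : ℕ}

/-! ## §1. Uniqueness of fluctuation parts -/

/-- **UNIQUENESS OF FLUCTUATION PARTS**: columns `Ψ_b` of block profile solving `(H_{V,a} + K)Ψ_b = 𝟙_{B b}`, uniqueness of bounded solutions
of `(H_{V,a} + K)u = f` ((237) (U)), and a decaying LEFT inverse `N` of the coarse matrix `T(b′,b) = (n+1)^{−d}Σ_{B b′}Ψ_b` (`NT = 1`) ⟹ every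
bounded `w` with vanishing block means and `(H_{V,a} + K)w = g∘blk` for a coarse-profile `g` VANISHES, and so does `g` — `w = Σ′_bg(b)Ψ_b`
((258) §1 + (U)), its block means `Σ′_bT(b′,b)g(b)` vanish, and `g = N(Tg) = 0` ((203)). [folklore] -/
theorem fluctuation_unique (n : ℕ) (a : ℝ) {ε γ μ ν CΨ CN νN Cg Bw : ℝ} (hε : 0 ≤ ε) (hγ : 0 < γ) (hν : 0 < ν) (hνμ : ν < μ)
    (hνN : 0 < νN)
    (V : X d → ℝ) (K : X d → X d → ℝ) (hK : ∀ p q, |K p q| ≤ ε * exp (-(γ * ∑ i, (((p i - q i).natAbs : ℕ) : ℝ))))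
    (Ψ : X d → X d → ℝ) (hΨd : ∀ c p, |Ψ c p| ≤ CΨ * exp (-(μ * ∑ i, (((blk n p i - c i).natAbs : ℕ) : ℝ))))
    (hΨ : ∀ c p, ((n : ℝ) + 1) ^ 2 * ∑ μ', (2 * Ψ c p - Ψ c (p + e μ') - Ψ c (p - e μ'))
        + a / ((n : ℝ) + 1) ^ d * ∑ q ∈ B n (blk n p), Ψ c q + V p * Ψ c p + ∑' q : X d, K p q * Ψ c q
          = if blk n p = c then 1 else 0)
    (hU : ∀ (f : X d → ℝ) (Mf : ℝ), (∀ p, |f p| ≤ Mf) → ∀ (u v : X d → ℝ) (Bu Bv : ℝ), (∀ p, |u p| ≤ Bu) → (∀ p, |v p| ≤ Bv) →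
        (∀ p, ((n : ℝ) + 1) ^ 2 * ∑ μ', (2 * u p - u (p + e μ') - u (p - e μ'))
          + a / ((n : ℝ) + 1) ^ d * ∑ q ∈ B n (blk n p), u q + V p * u p + ∑' q : X d, K p q * u q = f p) →
        (∀ p, ((n : ℝ) + 1) ^ 2 * ∑ μ', (2 * v p - v (p + e μ') - v (p - e μ'))
          + a / ((n : ℝ) + 1) ^ d * ∑ q ∈ B n (blk n p), v q + V p * v p + ∑' q : X d, K p q * v q = f p) →
        ∀ p, u p = v p)
    (N : X d → X d → ℝ) (hNd : ∀ b c, |N b c| ≤ CN * exp (-(νN * ∑ i, (((b i - c i).natAbs : ℕ) : ℝ))))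
    (hNT : ∀ c b, ∑' b' : X d, N c b' * ((((n : ℝ) + 1) ^ d)⁻¹ * ∑ q ∈ B n b', Ψ b q) = if c = b then 1 else 0)
    (c₀ : X d) (g : X d → ℝ) (hg : ∀ b, |g b| ≤ Cg * exp (-(ν * ∑ i, (((b i - c₀ i).natAbs : ℕ) : ℝ))))
    (w : X d → ℝ) (hwb : ∀ p, |w p| ≤ Bw) (hQw : ∀ b, (((n : ℝ) + 1) ^ d)⁻¹ * ∑ q ∈ B n b, w q = 0)
    (hHw : ∀ p, ((n : ℝ) + 1) ^ 2 * ∑ μ', (2 * w p - w (p + e μ') - w (p - e μ'))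
        + a / ((n : ℝ) + 1) ^ d * ∑ q ∈ B n (blk n p), w q + V p * w p + ∑' q : X d, K p q * w q = g (blk n p)) :
    (∀ p, w p = 0) ∧ (∀ b, g b = 0) := by
  classical
  have hμ : 0 < μ := hν.trans hνμ
  have hCΨ : 0 ≤ CΨ := by
    have h := (abs_nonneg _).trans (hΨd c₀ 0); exact le_of_mul_le_mul_right (by rw [zero_mul]; exact h) (exp_pos _)
  have hCg : 0 ≤ Cg := by
    have h := (abs_nonneg _).trans (hg c₀); exact le_of_mul_le_mul_right (by rw [zero_mul]; exact h) (exp_pos _)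
  have hgb : ∀ b, |g b| ≤ Cg := fun b =>
    (hg b).trans (mul_le_of_le_one_right hCg (exp_le_one_iff.2 (neg_nonpos.2 (by positivity))))
  -- the superposition `W = Σ′_bg(b)Ψ_b` solves the same equation with the same (bounded) source
  obtain ⟨hs, hWd, hWeq⟩ := column_superposition n a hε hγ hν hνμ V K hK Ψ hΨd hΨ c₀ g hg
  have hK0 : 0 ≤ (2 * (1 - exp (-(μ - ν)))⁻¹) ^ d :=
    pow_nonneg (mul_nonneg zero_le_two (inv_nonneg.2 (sub_nonneg.2 (exp_le_one_iff.2 (by linarith))))) d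
  have hWb : ∀ p, |∑' b : X d, g b * Ψ b p| ≤ Cg * CΨ * (2 * (1 - exp (-(μ - ν)))⁻¹) ^ d := fun p =>
    (hWd p).trans (mul_le_of_le_one_right (by positivity) (exp_le_one_iff.2 (neg_nonpos.2 (by positivity))))
  have hwW : ∀ p, w p = ∑' b : X d, g b * Ψ b p :=
    hU (fun p => g (blk n p)) Cg (fun p => hgb _) w _ Bw _ hwb hWb hHw hWeq
  -- the block means of `W` are `Σ′_bT(b′,b)g(b)`; they vanish
  have hmean : ∀ b', ∑' b : X d, ((((n : ℝ) + 1) ^ d)⁻¹ * ∑ q ∈ B n b', Ψ b q) * g b = 0 := by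
    intro b'
    have e : ∀ b : X d, ((((n : ℝ) + 1) ^ d)⁻¹ * ∑ q ∈ B n b', Ψ b q) * g b
        = (((n : ℝ) + 1) ^ d)⁻¹ * ∑ q ∈ B n b', g b * Ψ b q := fun b => by
      rw [Finset.mul_sum, Finset.mul_sum, Finset.sum_mul]
      exact Finset.sum_congr rfl fun q _ => by ring
    rw [tsum_congr e, tsum_mul_left, Summable.tsum_finsetSum (fun q _ => hs q)]
    have h0 := hQw b'
    rw [Finset.sum_congr rfl fun q _ => hwW q] at h0
    exact h0
  -- `g = N(Tg) = 0` by re-association through the bounded `g`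
  have hTd : ∀ b' b, |(((n : ℝ) + 1) ^ d)⁻¹ * ∑ q ∈ B n b', Ψ b q| ≤ CΨ * exp (-(μ * ∑ i, (((b' i - b i).natAbs : ℕ) : ℝ))) :=
    fun b' b => coarse_entry_le n Ψ b (hΨd b) b'
  have hg0 : ∀ c, g c = 0 := by
    intro c
    have h1 := kernel_comp_apply hνN hμ N (fun b' b => (((n : ℝ) + 1) ^ d)⁻¹ * ∑ q ∈ B n b', Ψ b q) hNd hTd g hgb c
    simp only [hmean, mul_zero, tsum_zero] at h1
    -- right side: `Σ′_b δ_{cb} g(b) = g(c)`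
    rw [tsum_congr fun b => by rw [hNT c b], tsum_eq_single c (fun b hb => by rw [if_neg (Ne.symm hb), zero_mul]),
      if_pos rfl, one_mul] at h1
    exact h1.symm
  refine ⟨fun p => ?_, hg0⟩
  rw [hwW p]
  simp only [hg0, zero_mul, tsum_zero]

/-! ## §2. The fluctuation covariance does not depend on the coupling -/

/-- **`C_{a′}f = C_af`**: with columns `Ψ′` at coupling `a′`, (U) at `a′`, a decaying left inverse `N′` of `T_{a′}`; bounded `w, w′` with
vanishing block means and `(H_{V,a} + K)w = f − c∘blk`, `(H_{V,a′} + K)w′ = f − c′∘blk` (`c, c′` of coarse profile about one centre — (221)'s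
displays of `C_af`, `C_{a′}f` for the SAME source `f`) ⟹ `w = w′` and `c = c′` — `Πw = 0` makes `w` solve the `a′`-displays with the same `c`,
and §1 at `a′`. [folklore] -/
theorem fluctuation_coupling_invariant (n : ℕ) (a a' : ℝ) {ε γ μ ν CΨ' CN νN Cc Cc' Bw Bw' : ℝ} (hε : 0 ≤ ε) (hγ : 0 < γ)
    (hν : 0 < ν) (hνμ : ν < μ) (hνN : 0 < νN)
    (V : X d → ℝ) (K : X d → X d → ℝ) (hK : ∀ p q, |K p q| ≤ ε * exp (-(γ * ∑ i, (((p i - q i).natAbs : ℕ) : ℝ))))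
    (Ψ' : X d → X d → ℝ) (hΨ'd : ∀ c p, |Ψ' c p| ≤ CΨ' * exp (-(μ * ∑ i, (((blk n p i - c i).natAbs : ℕ) : ℝ))))
    (hΨ' : ∀ c p, ((n : ℝ) + 1) ^ 2 * ∑ μ', (2 * Ψ' c p - Ψ' c (p + e μ') - Ψ' c (p - e μ'))
        + a' / ((n : ℝ) + 1) ^ d * ∑ q ∈ B n (blk n p), Ψ' c q + V p * Ψ' c p + ∑' q : X d, K p q * Ψ' c q
          = if blk n p = c then 1 else 0)
    (hU' : ∀ (f : X d → ℝ) (Mf : ℝ), (∀ p, |f p| ≤ Mf) → ∀ (u v : X d → ℝ) (Bu Bv : ℝ), (∀ p, |u p| ≤ Bu) → (∀ p, |v p| ≤ Bv) →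
        (∀ p, ((n : ℝ) + 1) ^ 2 * ∑ μ', (2 * u p - u (p + e μ') - u (p - e μ'))
          + a' / ((n : ℝ) + 1) ^ d * ∑ q ∈ B n (blk n p), u q + V p * u p + ∑' q : X d, K p q * u q = f p) →
        (∀ p, ((n : ℝ) + 1) ^ 2 * ∑ μ', (2 * v p - v (p + e μ') - v (p - e μ'))
          + a' / ((n : ℝ) + 1) ^ d * ∑ q ∈ B n (blk n p), v q + V p * v p + ∑' q : X d, K p q * v q = f p) →
        ∀ p, u p = v p)
    (N' : X d → X d → ℝ) (hN'd : ∀ b c, |N' b c| ≤ CN * exp (-(νN * ∑ i, (((b i - c i).natAbs : ℕ) : ℝ))))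
    (hN'T : ∀ c b, ∑' b' : X d, N' c b' * ((((n : ℝ) + 1) ^ d)⁻¹ * ∑ q ∈ B n b', Ψ' b q) = if c = b then 1 else 0)
    (f : X d → ℝ) (bf : X d) (w w' c c' : X d → ℝ) (hwb : ∀ p, |w p| ≤ Bw) (hw'b : ∀ p, |w' p| ≤ Bw')
    (hc : ∀ b, |c b| ≤ Cc * exp (-(ν * ∑ i, (((b i - bf i).natAbs : ℕ) : ℝ))))
    (hc' : ∀ b, |c' b| ≤ Cc' * exp (-(ν * ∑ i, (((b i - bf i).natAbs : ℕ) : ℝ))))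
    (hQw : ∀ b, (((n : ℝ) + 1) ^ d)⁻¹ * ∑ q ∈ B n b, w q = 0) (hQw' : ∀ b, (((n : ℝ) + 1) ^ d)⁻¹ * ∑ q ∈ B n b, w' q = 0)
    (hHw : ∀ p, ((n : ℝ) + 1) ^ 2 * ∑ μ', (2 * w p - w (p + e μ') - w (p - e μ'))
        + a / ((n : ℝ) + 1) ^ d * ∑ q ∈ B n (blk n p), w q + V p * w p + ∑' q : X d, K p q * w q = f p - c (blk n p))
    (hHw' : ∀ p, ((n : ℝ) + 1) ^ 2 * ∑ μ', (2 * w' p - w' (p + e μ') - w' (p - e μ'))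
        + a' / ((n : ℝ) + 1) ^ d * ∑ q ∈ B n (blk n p), w' q + V p * w' p + ∑' q : X d, K p q * w' q = f p - c' (blk n p)) :
    (∀ p, w p = w' p) ∧ (∀ b, c b = c' b) := by
  classical
  have hvol : (0 : ℝ) < ((n : ℝ) + 1) ^ d := by positivity
  -- `Πw = 0`: `w` solves the `a′`-equation with the same source
  have hPi : ∀ p, ∑ q ∈ B n (blk n p), w q = 0 := fun p => by
    have h := hQw (blk n p)
    rcases mul_eq_zero.1 h with h1 | h1
    · exact absurd h1 (inv_ne_zero hvol.ne')
    · exact h1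
  have hHw2 : ∀ p, ((n : ℝ) + 1) ^ 2 * ∑ μ', (2 * w p - w (p + e μ') - w (p - e μ'))
      + a' / ((n : ℝ) + 1) ^ d * ∑ q ∈ B n (blk n p), w q + V p * w p + ∑' q : X d, K p q * w q = f p - c (blk n p) := by
    intro p
    rw [← hHw p, hPi p, mul_zero, mul_zero]
  -- the kernel rows of `w`, `w′` converge (bounded functions against a decaying kernel)
  have hwb' : ∀ p, |w p| ≤ Bw := hwb
  have hsK : ∀ p, Summable fun q : X d => K p q * w q :=
    fun p => SupZdExponentialSums.summable_kernel_row hγ K hK w hwb p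
  have hsK' : ∀ p, Summable fun q : X d => K p q * w' q :=
    fun p => SupZdExponentialSums.summable_kernel_row hγ K hK w' hw'b p
  -- the difference is a fluctuation part at `a′` with block-constant image `(c′ − c)∘blk`
  obtain ⟨dw, hdw⟩ : ∃ dw : X d → ℝ, ∀ p, dw p = w p - w' p := ⟨_, fun _ => rfl⟩
  have hdb : ∀ p, |dw p| ≤ Bw + Bw' := fun p => by rw [hdw]; exact (abs_sub _ _).trans (add_le_add (hwb p) (hw'b p))
  have hQd : ∀ b, (((n : ℝ) + 1) ^ d)⁻¹ * ∑ q ∈ B n b, dw q = 0 := fun b => by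
    simp only [hdw, Finset.sum_sub_distrib, mul_sub, hQw, hQw', sub_self]
  have hg : ∀ b, |c' b - c b| ≤ (Cc' + Cc) * exp (-(ν * ∑ i, (((b i - bf i).natAbs : ℕ) : ℝ))) := fun b => by
    rw [add_mul]; exact (abs_sub _ _).trans (add_le_add (hc' b) (hc b))
  have hHd : ∀ p, ((n : ℝ) + 1) ^ 2 * ∑ μ', (2 * dw p - dw (p + e μ') - dw (p - e μ'))
      + a' / ((n : ℝ) + 1) ^ d * ∑ q ∈ B n (blk n p), dw q + V p * dw p + ∑' q : X d, K p q * dw q = c' (blk n p) - c (blk n p) := by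
    intro p
    have e1 : ∑ μ', (2 * dw p - dw (p + e μ') - dw (p - e μ'))
        = ∑ μ', (2 * w p - w (p + e μ') - w (p - e μ')) - ∑ μ', (2 * w' p - w' (p + e μ') - w' (p - e μ')) := by
      rw [← Finset.sum_sub_distrib]; exact Finset.sum_congr rfl fun μ' _ => by rw [hdw, hdw, hdw]; ring
    have e2 : ∑ q ∈ B n (blk n p), dw q = ∑ q ∈ B n (blk n p), w q - ∑ q ∈ B n (blk n p), w' q := by
      rw [← Finset.sum_sub_distrib]; exact Finset.sum_congr rfl fun q _ => hdw q
    have e3 : ∑' q : X d, K p q * dw q = ∑' q : X d, K p q * w q - ∑' q : X d, K p q * w' q := by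
      rw [← (hsK p).tsum_sub (hsK' p)]; exact tsum_congr fun q => by rw [hdw]; ring
    rw [e1, e2, e3, hdw p]
    have h1 := hHw2 p
    have h2 := hHw' p
    linear_combination h1 - h2
  obtain ⟨hd0, hg0⟩ := fluctuation_unique n a' hε hγ hν hνμ hνN V K hK Ψ' hΨ'd hΨ' hU' N' hN'd hN'T bf (fun b => c' b - c b) hg
    dw hdb hQd hHd
  exact ⟨fun p => sub_eq_zero.1 (by rw [← hdw]; exact hd0 p), fun b => (sub_eq_zero.1 (hg0 b)).symm⟩

/-! ## §3. THE END: the response kernels do not depend on the coupling; the Hessian shift, column by column -/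

/-- **HEADLINE — `h^{a′}_{b₀} = h^a_{b₀}` AND `N_{a′}(·,b₀) = N_a(·,b₀) + (a′−a)e_{b₀}`.**  With columns `Ψ′` at coupling `a′`, (U) at `a′` and a
decaying left inverse `N′` of `T_{a′}`: bounded `h, h′` with block means `Q′h = Q′h′ = e_{b₀}` and block-constant images `(H_{V,a} + K)h = m∘blk`,
`(H_{V,a′} + K)h′ = m′∘blk` (`m, m′` of coarse profile about `b₀` — (220)'s displays (ii), (iii) of the response kernels at the two couplings,
with `m = N_a(·,b₀)`, `m′ = N_{a′}(·,b₀)`) ⟹ `h = h′` pointwise and `m′ = m + (a′−a)e_{b₀}` — since `Πh = e_{b₀}∘blk`, `h` solves the `a′`-displays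
with the source `(m + (a′−a)e_{b₀})∘blk`, and §1 at `a′` kills `h − h′` together with its coarse datum. [folklore] -/
theorem response_coupling_invariant (n : ℕ) (a a' : ℝ) {ε γ μ ν CΨ' CN νN Cm Cm' Bh Bh' : ℝ} (hε : 0 ≤ ε) (hγ : 0 < γ)
    (hν : 0 < ν) (hνμ : ν < μ) (hνN : 0 < νN)
    (V : X d → ℝ) (K : X d → X d → ℝ) (hK : ∀ p q, |K p q| ≤ ε * exp (-(γ * ∑ i, (((p i - q i).natAbs : ℕ) : ℝ))))
    (Ψ' : X d → X d → ℝ) (hΨ'd : ∀ c p, |Ψ' c p| ≤ CΨ' * exp (-(μ * ∑ i, (((blk n p i - c i).natAbs : ℕ) : ℝ))))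
    (hΨ' : ∀ c p, ((n : ℝ) + 1) ^ 2 * ∑ μ', (2 * Ψ' c p - Ψ' c (p + e μ') - Ψ' c (p - e μ'))
        + a' / ((n : ℝ) + 1) ^ d * ∑ q ∈ B n (blk n p), Ψ' c q + V p * Ψ' c p + ∑' q : X d, K p q * Ψ' c q
          = if blk n p = c then 1 else 0)
    (hU' : ∀ (f : X d → ℝ) (Mf : ℝ), (∀ p, |f p| ≤ Mf) → ∀ (u v : X d → ℝ) (Bu Bv : ℝ), (∀ p, |u p| ≤ Bu) → (∀ p, |v p| ≤ Bv) →
        (∀ p, ((n : ℝ) + 1) ^ 2 * ∑ μ', (2 * u p - u (p + e μ') - u (p - e μ'))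
          + a' / ((n : ℝ) + 1) ^ d * ∑ q ∈ B n (blk n p), u q + V p * u p + ∑' q : X d, K p q * u q = f p) →
        (∀ p, ((n : ℝ) + 1) ^ 2 * ∑ μ', (2 * v p - v (p + e μ') - v (p - e μ'))
          + a' / ((n : ℝ) + 1) ^ d * ∑ q ∈ B n (blk n p), v q + V p * v p + ∑' q : X d, K p q * v q = f p) →
        ∀ p, u p = v p)
    (N' : X d → X d → ℝ) (hN'd : ∀ b c, |N' b c| ≤ CN * exp (-(νN * ∑ i, (((b i - c i).natAbs : ℕ) : ℝ))))
    (hN'T : ∀ c b, ∑' b' : X d, N' c b' * ((((n : ℝ) + 1) ^ d)⁻¹ * ∑ q ∈ B n b', Ψ' b q) = if c = b then 1 else 0)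
    (b₀ : X d) (h h' m m' : X d → ℝ) (hhb : ∀ p, |h p| ≤ Bh) (hh'b : ∀ p, |h' p| ≤ Bh')
    (hm : ∀ b, |m b| ≤ Cm * exp (-(ν * ∑ i, (((b i - b₀ i).natAbs : ℕ) : ℝ))))
    (hm' : ∀ b, |m' b| ≤ Cm' * exp (-(ν * ∑ i, (((b i - b₀ i).natAbs : ℕ) : ℝ))))
    (hQh : ∀ b, (((n : ℝ) + 1) ^ d)⁻¹ * ∑ q ∈ B n b, h q = if b = b₀ then 1 else 0)
    (hQh' : ∀ b, (((n : ℝ) + 1) ^ d)⁻¹ * ∑ q ∈ B n b, h' q = if b = b₀ then 1 else 0)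
    (hHh : ∀ p, ((n : ℝ) + 1) ^ 2 * ∑ μ', (2 * h p - h (p + e μ') - h (p - e μ'))
        + a / ((n : ℝ) + 1) ^ d * ∑ q ∈ B n (blk n p), h q + V p * h p + ∑' q : X d, K p q * h q = m (blk n p))
    (hHh' : ∀ p, ((n : ℝ) + 1) ^ 2 * ∑ μ', (2 * h' p - h' (p + e μ') - h' (p - e μ'))
        + a' / ((n : ℝ) + 1) ^ d * ∑ q ∈ B n (blk n p), h' q + V p * h' p + ∑' q : X d, K p q * h' q = m' (blk n p)) :
    (∀ p, h p = h' p) ∧ (∀ b, m' b = m b + (a' - a) * (if b = b₀ then 1 else 0)) := by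
  classical
  have hvol : (0 : ℝ) < ((n : ℝ) + 1) ^ d := by positivity
  -- `Πh = e_{b₀}∘blk`: `h` solves the `a′`-equation with the source `(m + (a′−a)e_{b₀})∘blk`
  have hPi : ∀ p, (((n : ℝ) + 1) ^ d)⁻¹ * ∑ q ∈ B n (blk n p), h q = if blk n p = b₀ then 1 else 0 := fun p => hQh (blk n p)
  have hHh2 : ∀ p, ((n : ℝ) + 1) ^ 2 * ∑ μ', (2 * h p - h (p + e μ') - h (p - e μ'))
      + a' / ((n : ℝ) + 1) ^ d * ∑ q ∈ B n (blk n p), h q + V p * h p + ∑' q : X d, K p q * h q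
      = m (blk n p) + (a' - a) * (if blk n p = b₀ then 1 else 0) := by
    intro p
    rw [← hHh p, ← hPi p, div_eq_mul_inv, div_eq_mul_inv]
    ring
  -- the kernel rows of `h`, `h′` converge
  have hsK : ∀ p, Summable fun q : X d => K p q * h q :=
    fun p => SupZdExponentialSums.summable_kernel_row hγ K hK h hhb p
  have hsK' : ∀ p, Summable fun q : X d => K p q * h' q :=
    fun p => SupZdExponentialSums.summable_kernel_row hγ K hK h' hh'b p
  -- the difference is a fluctuation part at `a′` with the coarse datum `g = m + (a′−a)e_{b₀} − m′`
  obtain ⟨dh, hdh⟩ : ∃ dh : X d → ℝ, ∀ p, dh p = h p - h' p := ⟨_, fun _ => rfl⟩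
  obtain ⟨g, hgdef⟩ : ∃ g : X d → ℝ, ∀ b, g b = m b + (a' - a) * (if b = b₀ then 1 else 0) - m' b := ⟨_, fun _ => rfl⟩
  have hdb : ∀ p, |dh p| ≤ Bh + Bh' := fun p => by rw [hdh]; exact (abs_sub _ _).trans (add_le_add (hhb p) (hh'b p))
  have hQd : ∀ b, (((n : ℝ) + 1) ^ d)⁻¹ * ∑ q ∈ B n b, dh q = 0 := fun b => by
    simp only [hdh, Finset.sum_sub_distrib, mul_sub, hQh, hQh', sub_self]
  have hg : ∀ b, |g b| ≤ (Cm + |a' - a| + Cm') * exp (-(ν * ∑ i, (((b i - b₀ i).natAbs : ℕ) : ℝ))) := by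
    intro b
    rw [hgdef, add_mul, add_mul]
    refine (abs_sub _ _).trans (add_le_add ((abs_add_le _ _).trans (add_le_add (hm b) ?_)) (hm' b))
    split_ifs with hb
    · subst hb; simp
    · rw [mul_zero, abs_zero]; positivity
  have hHd : ∀ p, ((n : ℝ) + 1) ^ 2 * ∑ μ', (2 * dh p - dh (p + e μ') - dh (p - e μ'))
      + a' / ((n : ℝ) + 1) ^ d * ∑ q ∈ B n (blk n p), dh q + V p * dh p + ∑' q : X d, K p q * dh q = g (blk n p) := by
    intro p
    have e1 : ∑ μ', (2 * dh p - dh (p + e μ') - dh (p - e μ'))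
        = ∑ μ', (2 * h p - h (p + e μ') - h (p - e μ')) - ∑ μ', (2 * h' p - h' (p + e μ') - h' (p - e μ')) := by
      rw [← Finset.sum_sub_distrib]; exact Finset.sum_congr rfl fun μ' _ => by rw [hdh, hdh, hdh]; ring
    have e2 : ∑ q ∈ B n (blk n p), dh q = ∑ q ∈ B n (blk n p), h q - ∑ q ∈ B n (blk n p), h' q := by
      rw [← Finset.sum_sub_distrib]; exact Finset.sum_congr rfl fun q _ => hdh q
    have e3 : ∑' q : X d, K p q * dh q = ∑' q : X d, K p q * h q - ∑' q : X d, K p q * h' q := by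
      rw [← (hsK p).tsum_sub (hsK' p)]; exact tsum_congr fun q => by rw [hdh]; ring
    rw [e1, e2, e3, hdh p, hgdef]
    have h1 := hHh2 p
    have h2 := hHh' p
    linear_combination h1 - h2
  obtain ⟨hd0, hg0⟩ := fluctuation_unique n a' hε hγ hν hνμ hνN V K hK Ψ' hΨ'd hΨ' hU' N' hN'd hN'T b₀ g hg dh hdb hQd hHd
  refine ⟨fun p => sub_eq_zero.1 (by rw [← hdh]; exact hd0 p), fun b => ?_⟩
  have h0 := hg0 b
  rw [hgdef] at h0
  linarith

/-! ## §4. Toy -/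

/-- Toy (`d = 1`): the coarse datum of §3's comparison, `m + (a′−a)e_{b₀} − m′`, vanishes when `m′ = m + (a′−a)e_{b₀}` — the Hessian shift
read on one column. -/
example (m : X 1 → ℝ) (a a' : ℝ) (b b₀ : X 1) :
    m b + (a' - a) * (if b = b₀ then (1 : ℝ) else 0) - (m b + (a' - a) * (if b = b₀ then 1 else 0)) = 0 := by
  ring

end Summit.QuantumFields.BalabanUV.T4Continuum.NE7b.SupZdCouplingInvariance
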